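/-
Copyright (c) 2026 the pub-hodgecm-mathlib formalisation cell (harness21).  Prover seat hodgecm-mathlib-F0P3a-p03 (g21), 2026-09-02 (LH7 leaf ED. 3 road, letter O8a, step (2) of the
in-house road of `F0/P3a/F0P3a-p03/g21/CENSUS-O8a-PKsaU2.F0P3ap03g21.md`: «a conjugation-stable set fixing one non-zero vector of an irreducible representation fixes everything»).
-/
import Literature.NumberTheory.Automorphic.HilbertRepSpectrum                  -- ★ `ContRepresentation.ClosedSubrep`, `IsTopIrreducible`, `isTopIrreducible_iff`
import Literature.NumberTheory.Automorphic.UnitaryGroupCohomologicalForms          -- ★ `DiscreteAutomorphicRep.finRep`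
import Literature.NumberTheory.Automorphic.UnitaryGroupPlaceInclusion              -- ★ `inclPlace`, `exists_eq_mul_inclPlace`, `commute_inclPlace_of_evalPlace_eq_one`, `commute_archToAdelic_finAdelicToAdelic`
import HarnessLib

/-!
# A conjugation-stable set of group elements that fixes ONE non-zero vector of a topologically irreducible representation acts trivially;
# for a discrete automorphic `P` of `U(J)`: if `SU(J)(F_v)` fixes a finite component `σ ↪ P`, it fixes all of `P`

Topic `NumberTheory/Automorphic`; namespaces `ContRepresentation` (generic, dot notation on ★ `IsTopIrreducible`) and `….UnitaryGroup` ∕ `DiscreteAutomorphicRep.…` (adelic dress).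
THEOREMS ONLY: no definition, no named fact, no instance, no notation, no `sorry`.

THE MATHEMATICS.  (§1) Let `π` be a continuous representation of a group `G` on a Hausdorff topological vector space `V`, topologically irreducible (★ `IsTopIrreducible`: the only
closed invariant subspaces are `0` and `V`), and let `S ⊆ G` be stable under conjugation (`g⁻¹ s g ∈ S` for `s ∈ S`, `g ∈ G`).  The common fixed space `V^S = {v | π s v = v ∀ s ∈ S}` is a
CLOSED (`π s` continuous, `V` Hausdorff) INVARIANT (`π s (π g v) = π g (π (g⁻¹ s g) v)`) subspace; so if it contains a non-zero vector it is all of `V`: `S` acts trivially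
(`apply_eq_self_of_conj_mem_of_exists_ne_zero`).  (§2) For the adelic unitary group `U(J)(𝔸_F) = U(J)(F ⊗ ℝ) · U(J)(𝔸_{F,f})`: a subset `S_f ⊆ U(J)(𝔸_{F,f})` stable under
`U(J)(𝔸_{F,f})`-conjugation has conjugation-stable image in `U(J)(𝔸_F)` (the archimedean factor commutes with the finite one, ★ `commute_archToAdelic_finAdelicToAdelic`); so for a
DISCRETE AUTOMORPHIC `P` (topologically irreducible by definition) and a representation `σ` of `U(J)(𝔸_{F,f})` with an INJECTIVE intertwiner `ι : σ → P|_{U(J)(𝔸_{F,f})}` on a non-trivial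
space: if `S_f` fixes `σ` pointwise then `S_f` fixes ALL of `P` (`DiscreteAutomorphicRep.toContRep_finAdelicToAdelic_apply_eq_self_of_forall_conj_mem`).  (§3) The instance the O8a road
consumes: `S_f = ι_v(SU(J)(F_v))`, the image under ★ `inclPlace v` of the elements of `U(J)(F_v)` all of whose components have determinant `1` — conjugation-stable because
`g ι_v(u) g⁻¹ = ι_v(g_v u g_v⁻¹)` (★ `exists_eq_mul_inclPlace` ∕ ★ `commute_inclPlace_of_evalPlace_eq_one`) and determinants are conjugation-invariant
(`DiscreteAutomorphicRep.toContRep_inclPlaceAdelic_apply_eq_self_of_forall_det_eq_one`): «if `SU(J)(F_v)` acts trivially on a finite component of `P`, it acts trivially on `P`».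
CONSUMER (cell `hodgecm-mathlib`, crux H413, line LH7, letter O8a `PKsaU2Shape`, road step (2) of the census memo): with ★ p850555 (local character isotypy on `σ`) and ★ Dieudonné
`UnitaryIsotropic.apply_eq_one_of_det_eq_one` (characters kill `SU`), every discrete automorphic `P` realising a family one-dimensional at `v` is fixed by `R(ι_v SU(Φ₂)(L⁺_v))` — the input
of the strong-approximation step.  HONEST LABEL: generic ([Dixmier1977] §13.1; [BorelJacquet1979] §4.6); HC_CM is proved only modulo the printed citations of that programme until its rung 0
closes; this file proves no printed citation of it.

## References
* [Dixmier1977] J. Dixmier, *C\*-algebras* (1977), §13.1.5 (topological irreducibility).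
* [BorelJacquet1979] A. Borel, H. Jacquet, *Automorphic forms and automorphic representations*, Corvallis (1979), §4.6.
* [PlatonovRapinchuk1994] V. Platonov, A. Rapinchuk, *Algebraic Groups and Number Theory* (1994), §5.1, §7.4 (the role of `SU_{v₁}` in Kneser's argument).
-/

set_option autoImplicit false

noncomputable section

open MeasureTheory NumberField IsDedekindDomain

/-! ## §1 Generic: a conjugation-stable set fixing a non-zero vector of an irreducible representation acts trivially -/

namespace ContRepresentation

variable {R G V : Type*} [Ring R] [Group G] [AddCommGroup V] [TopologicalSpace V] [IsTopologicalAddGroup V] [T2Space V] [Module R V]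

/-- **A conjugation-stable set fixing ONE non-zero vector of a topologically irreducible representation acts trivially.**  `π` topologically irreducible, `S ⊆ G` with `g⁻¹ s g ∈ S` for
all `s ∈ S`, `g ∈ G`, and `π s w = w` for all `s ∈ S` for some `w ≠ 0`; then `π s v = v` for all `s ∈ S` and ALL `v` (the common fixed space of `S` is a closed invariant subspace `≠ 0`).
[cite: Dixmier1977, §13.1.5] -/
theorem IsTopIrreducible.apply_eq_self_of_conj_mem_of_exists_ne_zero {π : ContRepresentation R G V} (hπ : π.IsTopIrreducible) (S : Set G)
    (hS : ∀ g : G, ∀ s ∈ S, g⁻¹ * s * g ∈ S) {w : V} (hw0 : w ≠ 0) (hw : ∀ s ∈ S, π s w = w) (s : G) (hs : s ∈ S) (v : V) : π s v = v := by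
  -- the common fixed space of `S` as a closed subrepresentation
  let W₀ : ClosedSubrep π :=
    { toSubmodule :=
        { carrier := {v | ∀ s ∈ S, π s v = v}
          add_mem' := fun {a b} ha hb s hs => by rw [map_add, ha s hs, hb s hs]
          zero_mem' := fun s _ => map_zero _
          smul_mem' := fun r a ha s hs => by rw [map_smul, ha s hs] }
      apply_mem_toSubmodule := fun g v hv s hs => by
        change π s (π g v) = π g v
        change ∀ s ∈ S, π s v = v at hv
        have key : π s (π g v) = π g (π (g⁻¹ * s * g) v) := by
          calc π s (π g v) = (π s * π g) v := rfl
            _ = π (g * (g⁻¹ * s * g)) v := by rw [← map_mul, show g * (g⁻¹ * s * g) = s * g by group]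
            _ = (π g * π (g⁻¹ * s * g)) v := by rw [map_mul]
            _ = π g (π (g⁻¹ * s * g) v) := rfl
        rw [key, hv _ (hS g s hs)]
      isClosed' := by
        change IsClosed {v : V | ∀ s ∈ S, π s v = v}
        have h : {v : V | ∀ s ∈ S, π s v = v} = ⋂ s ∈ S, {v : V | π s v = v} := by
          ext v
          simp only [Set.mem_setOf_eq, Set.mem_iInter]
        rw [h]
        exact isClosed_biInter fun s _ => isClosed_eq (π s).continuous continuous_id }
  have hwW : w ∈ W₀ := hw
  rcases ((isTopIrreducible_iff π).1 hπ).2 W₀ with h0 | htop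
  · exact absurd ((ClosedSubrep.mem_bot (π := π)).1 (h0 ▸ hwW)) hw0
  · have hv : v ∈ W₀ := htop ▸ ClosedSubrep.mem_top v
    exact hv s hs

end ContRepresentation

namespace Literature.NumberTheory.Automorphic

/-! ## §2 Adelic unitary groups: a `U(J)(𝔸_{F,f})`-conjugation-stable `S_f` fixing a finite component of a discrete automorphic `P` fixes `P` -/

namespace UnitaryGroup

variable (F E : Type) [Field F] [NumberField F] [Field E] [NumberField E] [Algebra F E]
variable (c : E ≃ₐ[F] E) (N : ℕ) (J : Matrix (Fin N) (Fin N) E)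

variable {F}

/-- **The image in `U(J)(𝔸_F)` of a `U(J)(𝔸_{F,f})`-conjugation-stable set is `U(J)(𝔸_F)`-conjugation-stable** (`a = a_∞ a_f` ★ `archToAdelic_mul_finAdelicToAdelic`; the archimedean factor
commutes with the finite one ★ `commute_archToAdelic_finAdelicToAdelic`). [cite: BorelJacquet1979, §4.1] -/
theorem conj_finAdelicToAdelic_mem_image (S : Set (finAdelic F E c N J)) (hS : ∀ g : finAdelic F E c N J, ∀ s ∈ S, g⁻¹ * s * g ∈ S)
    (a : (adelicGroupData F E c N J).Adelic) {x : (adelicGroupData F E c N J).Adelic} (hx : x ∈ finAdelicToAdelic F E c N J '' S) :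
    a⁻¹ * x * a ∈ finAdelicToAdelic F E c N J '' S := by
  obtain ⟨s, hs, rfl⟩ := hx
  refine ⟨(finPart F E c N J a)⁻¹ * s * finPart F E c N J a, hS _ s hs, ?_⟩
  have ha := archToAdelic_mul_finAdelicToAdelic F E c N J a
  have hcomm := (commute_archToAdelic_finAdelicToAdelic F E c N J (archPart F E c N J a) s).eq
  rw [map_mul, map_mul, map_inv]
  conv_rhs => rw [← ha, mul_inv_rev]
  rw [show ((finAdelicToAdelic F E c N J (finPart F E c N J a))⁻¹ * (archToAdelic F E c N J (archPart F E c N J a))⁻¹) * finAdelicToAdelic F E c N J s *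
        (archToAdelic F E c N J (archPart F E c N J a) * finAdelicToAdelic F E c N J (finPart F E c N J a)) =
      (finAdelicToAdelic F E c N J (finPart F E c N J a))⁻¹ * ((archToAdelic F E c N J (archPart F E c N J a))⁻¹ *
        (finAdelicToAdelic F E c N J s * archToAdelic F E c N J (archPart F E c N J a))) * finAdelicToAdelic F E c N J (finPart F E c N J a) by
      simp only [mul_assoc], ← hcomm, inv_mul_cancel_left]

/-- **A conjugation-stable `S_f ⊆ U(J)(𝔸_{F,f})` that fixes a finite component fixes the whole discrete automorphic representation.**  `P` discrete automorphic of `U(J)`; `σ` a representation of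
`U(J)(𝔸_{F,f})` on a non-trivial `W` with an INJECTIVE intertwiner `ι : σ → P.finRep`; `S_f` stable under `U(J)(𝔸_{F,f})`-conjugation with `σ s = 1` on `W` for `s ∈ S_f`.  Then
`R(s) f = f` for every `s ∈ S_f` and EVERY `f ∈ P` (§1 for the topologically irreducible `P`, with the non-zero fixed vector `ι w`). [cite: Dixmier1977, §13.1.5] [cite: BorelJacquet1979, §4.6] -/
theorem _root_.Literature.NumberTheory.Automorphic.DiscreteAutomorphicRep.toContRep_finAdelicToAdelic_apply_eq_self_of_forall_conj_mem
    {μ : Measure (adelicGroupData F E c N J).automorphicQuotient} [(adelicGroupData F E c N J).IsAutomorphicMeasure μ]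
    (P : DiscreteAutomorphicRep (adelicGroupData F E c N J) μ)
    {W : Type} [AddCommGroup W] [Module ℂ W] [Nontrivial W] (σ : Representation ℂ (finAdelic F E c N J) W) (ι : σ.IntertwiningMap P.finRep) (hι : Function.Injective ι)
    (S : Set (finAdelic F E c N J)) (hS : ∀ g : finAdelic F E c N J, ∀ s ∈ S, g⁻¹ * s * g ∈ S) (hfix : ∀ s ∈ S, ∀ w : W, σ s w = w)
    (s : finAdelic F E c N J) (hs : s ∈ S) (f : ↥P.space.toSubmodule) :
    P.space.toContRep (finAdelicToAdelic F E c N J s) f = f := by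
  obtain ⟨w, hw0⟩ := exists_ne (0 : W)
  have hιw0 : ι w ≠ 0 := fun h => hw0 (hι (by rw [h, map_zero]))
  have hfix' : ∀ x ∈ finAdelicToAdelic F E c N J '' S, P.space.toContRep x (ι w) = ι w := by
    rintro _ ⟨s', hs', rfl⟩
    have h := ι.isIntertwining (g := s') (v := w)
    rw [hfix s' hs' w] at h
    -- `ι (σ s' w) = P.finRep s' (ι w)` and `P.finRep s' = R(finAdelicToAdelic s')`
    exact h.symm
  exact P.irreducible.apply_eq_self_of_conj_mem_of_exists_ne_zero (finAdelicToAdelic F E c N J '' S)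
    (fun a x hx => conj_finAdelicToAdelic_mem_image E c N J S hS a hx) hιw0 hfix' _ (Set.mem_image_of_mem _ hs) f

/-! ## §3 The instance `S_f = ι_v(SU(J)(F_v))` -/

omit [NumberField F] in
/-- determinants of the components are conjugation-invariant in `Π_{w ∣ v} GL_N(E_w)` (plumbing). [folklore] -/
private theorem det_apply_conj_eq (v : HeightOneSpectrum (𝓞 F)) (g u : LocalGLPi E N v) (w : PlacesOver E v) :
    (((g⁻¹ * u * g) w : GL (Fin N) (w.1.adicCompletion E)) : Matrix (Fin N) (Fin N) (w.1.adicCompletion E)).det =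
      ((u w : GL (Fin N) (w.1.adicCompletion E)) : Matrix (Fin N) (Fin N) (w.1.adicCompletion E)).det := by
  rw [← Matrix.GeneralLinearGroup.val_det_apply, ← Matrix.GeneralLinearGroup.val_det_apply, Pi.mul_apply, Pi.mul_apply, Pi.inv_apply, map_mul, map_mul, map_inv,
    mul_right_comm, inv_mul_cancel, one_mul]

/-- **`ι_v(SU(J)(F_v))` is conjugation-stable in `U(J)(𝔸_{F,f})`**: for `u ∈ U(J)(F_v)` with all `det u_w = 1` and `g ∈ U(J)(𝔸_{F,f})`, `g⁻¹ ι_v(u) g = ι_v(g_v⁻¹ u g_v)` has again all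
component determinants `1` (★ `exists_eq_mul_inclPlace`, ★ `commute_inclPlace_of_evalPlace_eq_one`). [cite: PlatonovRapinchuk1994, §5.1] -/
theorem conj_mem_image_inclPlace_det_eq_one (v : HeightOneSpectrum (𝓞 F)) (g : finAdelic F E c N J) {s : finAdelic F E c N J}
    (hs : s ∈ inclPlace F E c N J v '' {u : ↥(localPi E c N J v) |
      ∀ w : PlacesOver E v, (((u : LocalGLPi E N v) w : GL (Fin N) (w.1.adicCompletion E)) : Matrix (Fin N) (Fin N) (w.1.adicCompletion E)).det = 1}) :
    g⁻¹ * s * g ∈ inclPlace F E c N J v '' {u : ↥(localPi E c N J v) |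
      ∀ w : PlacesOver E v, (((u : LocalGLPi E N v) w : GL (Fin N) (w.1.adicCompletion E)) : Matrix (Fin N) (Fin N) (w.1.adicCompletion E)).det = 1} := by
  obtain ⟨u, hu, rfl⟩ := hs
  set gv := evalPlace F E c N J v g with hgv
  obtain ⟨g', hg'1, -, hg⟩ := exists_eq_mul_inclPlace F E c N J v g
  rw [← hgv] at hg
  refine ⟨gv⁻¹ * u * gv, fun w => ?_, ?_⟩
  · rw [Subgroup.coe_mul, Subgroup.coe_mul, Subgroup.coe_inv, det_apply_conj_eq]
    exact hu w
  · have hc' := (commute_inclPlace_of_evalPlace_eq_one F E c N J hg'1 u).eq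
    rw [map_mul, map_mul, map_inv, hg, mul_inv_rev]
    rw [show (inclPlace F E c N J v gv)⁻¹ * g'⁻¹ * inclPlace F E c N J v u * (g' * inclPlace F E c N J v gv) =
        (inclPlace F E c N J v gv)⁻¹ * (g'⁻¹ * (inclPlace F E c N J v u * g')) * inclPlace F E c N J v gv by simp only [mul_assoc], ← hc', inv_mul_cancel_left]

/-- **«If `SU(J)(F_v)` acts trivially on a finite component of `P`, it acts trivially on `P`.»**  `P` discrete automorphic of `U(J)`, `σ` on a non-trivial `W` with an injective intertwiner
`ι : σ → P.finRep`, `v` a finite place; if `σ (inclPlace v u) = 1` on `W` for every `u ∈ U(J)(F_v)` all of whose components have determinant `1`, then `R(ι_v u) f = f` for every such `u` and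
EVERY `f ∈ P` — step (2) of the in-house O8a road (its input is ★ p850555 + ★ Dieudonné; its output feeds the strong-approximation step). [cite: BorelJacquet1979, §4.6] [cite: PlatonovRapinchuk1994, §7.4] -/
theorem _root_.Literature.NumberTheory.Automorphic.DiscreteAutomorphicRep.toContRep_inclPlaceAdelic_apply_eq_self_of_forall_det_eq_one
    {μ : Measure (adelicGroupData F E c N J).automorphicQuotient} [(adelicGroupData F E c N J).IsAutomorphicMeasure μ]
    (P : DiscreteAutomorphicRep (adelicGroupData F E c N J) μ)
    {W : Type} [AddCommGroup W] [Module ℂ W] [Nontrivial W] (σ : Representation ℂ (finAdelic F E c N J) W) (ι : σ.IntertwiningMap P.finRep) (hι : Function.Injective ι)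
    (v : HeightOneSpectrum (𝓞 F))
    (hfix : ∀ u : ↥(localPi E c N J v), (∀ w : PlacesOver E v, (((u : LocalGLPi E N v) w : GL (Fin N) (w.1.adicCompletion E)) : Matrix (Fin N) (Fin N) (w.1.adicCompletion E)).det = 1) →
      ∀ x : W, σ (inclPlace F E c N J v u) x = x)
    (u : ↥(localPi E c N J v)) (hu : ∀ w : PlacesOver E v, (((u : LocalGLPi E N v) w : GL (Fin N) (w.1.adicCompletion E)) : Matrix (Fin N) (Fin N) (w.1.adicCompletion E)).det = 1)
    (f : ↥P.space.toSubmodule) :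
    P.space.toContRep (inclPlaceAdelic F E c N J v u) f = f := by
  rw [inclPlaceAdelic_apply]
  refine DiscreteAutomorphicRep.toContRep_finAdelicToAdelic_apply_eq_self_of_forall_conj_mem E c N J P σ ι hι
    (inclPlace F E c N J v '' {u : ↥(localPi E c N J v) |
      ∀ w : PlacesOver E v, (((u : LocalGLPi E N v) w : GL (Fin N) (w.1.adicCompletion E)) : Matrix (Fin N) (Fin N) (w.1.adicCompletion E)).det = 1})
    (fun g s hs => conj_mem_image_inclPlace_det_eq_one E c N J v g hs) ?_ _ (Set.mem_image_of_mem _ hu) f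
  rintro _ ⟨u', hu', rfl⟩ x
  exact hfix u' hu' x

end UnitaryGroup

end Literature.NumberTheory.Automorphic

end
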